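import Literature.AlgebraicGeometry.Motives.AbelianVarietyGoodReductionFrobenius
import HarnessLib

/-!
# The `ℓ`-adic specialisation datum from a reduction map on geometric points
# (Serre–Tate 1968 §1 Lemma 2; Shimura 1998 §11.1 Prop. 14 (i), §19.4 (19.4a))

[SerreTate1968] J.-P. Serre, J. Tate, *Good reduction of abelian varieties*, Ann. of Math. 88 (1968), §1, Lemma 2
(«the reduction map defines an isomorphism `A_m^I ≅ Ã_m`, commuting with the action of `D(v̄)`»).
[Shimura1998] G. Shimura, *Abelian Varieties with Complex Multiplication and Modular Functions* (1998), §11.1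
Prop. 14 (i) («`M_l(λ) = M_l(λ̃)`»), §19.4 (19.4a) («`(t^σ)~ = φ_𝔭(t̃)`»).

Topic `Literature/AlgebraicGeometry/Motives`, namespace `Literature.AlgebraicGeometry.Motives.AbelianVariety.GoodReductionAt`.
THEOREMS ONLY (no definition, no named fact, no instance).  Cell `hodgecm-mathlib` (D-0151), background programme
R-pkg (director BATCH 67, lead B-p20), piece T7a = the PURE `T_ℓ`-PACKAGING of the tree's hypothesis structure
`GoodReductionAt.TateSpecialisation R ℓ` (`Motives/AbelianVarietyGoodReductionFrobenius` :396): given a good-reduction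
datum `R` of `A₀` at `v`, a prime `𝔓 ∣ v` of `ℤ̄_K`, and a REDUCTION MAP `red : A₀(K̄) →+ Ā(κ̄)` on geometric points
which (i) induces a bijection `T_ℓ(red)` on Tate modules (it is injective and surjective on every `ℓⁿ`-torsion —
R-pkg T1/T3), (ii) is fixed by the inertia of `𝔓` on the `ℓ`-power torsion (T4), (iii) carries every arithmetic
Frobenius at `𝔓` to the Frobenius endomorphism of `Ā` (T5) and (iv) intertwines `f` with `R.redEnd f` (T6) — all on
the `ℓ`-power torsion POINTS — the datum `TateSpecialisation R ℓ` with `prime = 𝔓` and `equiv = T_ℓ(red)` EXISTS.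
No geometry here: the three fields of the structure are the componentwise (`TateModule.proj`) readings of (ii)–(iv).
HC_CM is proved only modulo the printed citations until rung 0 closes.
-/

noncomputable section

open CategoryTheory AlgebraicGeometry IsDedekindDomain
open scoped NumberField

namespace Literature.AlgebraicGeometry.Motives

namespace AbelianVariety

namespace GoodReductionAt

open Literature.NumberTheory.GaloisRepresentations
open Literature.NumberTheory.EllipticCurves (TateModule)

variable {K : Type} [Field K] [NumberField K] {A₀ : AbelianVariety K} {v : HeightOneSpectrum (𝓞 K)}

omit [NumberField K] in
/-- `a_n ∈ A₀[ℓⁿ](K̄)` (as the `ℤ`-indexed `geomTorsion`) for every `a ∈ T_ℓ A₀`. [cite: SerreTate1968, §1] -/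
theorem proj_mem_geomTorsion (ℓ : ℕ) [Fact ℓ.Prime] (a : A₀.tateModule ℓ) (n : ℕ) :
    TateModule.proj ℓ n a ∈ A₀.geomTorsion (ℓ ^ n : ℕ) := by
  rw [mem_geomTorsion_iff', natCast_zsmul]
  exact TateModule.pow_smul_proj n a

/-- **The `ℓ`-adic specialisation datum from a reduction map** (Serre–Tate §1 Lemma 2 + Shimura (19.4a) + Prop. 14 (i),
packaged): see the module docstring.  The conclusion also records the two identifications consumers need:
`T.prime = 𝔓` and `(T.equiv a)_n = red (a_n)`.
[cite: SerreTate1968, §1 Lemma 2] [cite: Shimura1998, §11.1 Prop. 14 (i); §19.4 (19.4a)] -/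
theorem exists_tateSpecialisation_of_reductionMap (R : A₀.GoodReductionAt v) (ℓ : ℕ) [Fact ℓ.Prime]
    (𝔓 : Ideal (absIntegers (𝓞 K) K)) (h𝔓 : 𝔓 ∈ v.primesAbove)
    (red : A₀.geomPoints →+ R.reduction.geomPoints)
    (hbij : Function.Bijective (TateModule.map ℓ red))
    (hinert : ∀ (n : ℕ) (σ : Field.absoluteGaloisGroup K), σ ∈ 𝔓.inertia (Field.absoluteGaloisGroup K) →
      ∀ x : A₀.geomPoints, x ∈ A₀.geomTorsion (ℓ ^ n : ℕ) → σ • x = x)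
    (hfrob : ∀ (n : ℕ) (σ : Field.absoluteGaloisGroup K), IsArithFrobAt (𝓞 K) σ 𝔓 →
      ∀ x : A₀.geomPoints, x ∈ A₀.geomTorsion (ℓ ^ n : ℕ) →
        red (σ • x) = Hom.geomPointsMap (frobeniusHom R.reduction) (red x))
    (hend : ∀ (n : ℕ) (f : End A₀) (x : A₀.geomPoints), x ∈ A₀.geomTorsion (ℓ ^ n : ℕ) →
      red (Hom.geomPointsMap (f : A₀ ⟶ A₀) x) =
        Hom.geomPointsMap (R.redEnd f : R.reduction ⟶ R.reduction) (red x)) :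
    ∃ T : R.TateSpecialisation ℓ, T.prime = 𝔓 ∧
      ∀ (a : A₀.tateModule ℓ) (n : ℕ), TateModule.proj ℓ n (T.equiv a) = red (TateModule.proj ℓ n a) := by
  refine ⟨{ prime := 𝔓
            prime_mem := h𝔓
            equiv := LinearEquiv.ofBijective (TateModule.map ℓ red) hbij
            smul_eq_self_of_mem_inertia := fun σ hσ x => ?_
            equiv_smul := fun σ hσ x => ?_
            equiv_tateModuleMap := fun f x => ?_ }, rfl, fun a n => rfl⟩
  · -- (a) inertia acts trivially: componentwise on `A₀[ℓⁿ](K̄)`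
    exact TateModule.ext fun n => by
      rw [TateModule.proj_smul_of_distribMulAction]
      exact hinert n σ hσ _ (proj_mem_geomTorsion ℓ x n)
  · -- (b) (19.4a): `red (σ • a_n) = Frob (red a_n)`
    exact TateModule.ext fun n => by
      rw [LinearEquiv.ofBijective_apply, LinearEquiv.ofBijective_apply, TateModule.proj_map,
        TateModule.proj_smul_of_distribMulAction, tateModuleMap, TateModule.proj_map, TateModule.proj_map]
      exact hfrob n σ hσ _ (proj_mem_geomTorsion ℓ x n)
  · -- (c) Prop. 14 (i): `red (f a_n) = (redEnd f) (red a_n)`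
    exact TateModule.ext fun n => by
      rw [LinearEquiv.ofBijective_apply, LinearEquiv.ofBijective_apply, TateModule.proj_map, tateModuleMap,
        TateModule.proj_map, tateModuleMap, TateModule.proj_map, TateModule.proj_map]
      exact hend n f _ (proj_mem_geomTorsion ℓ x n)

end GoodReductionAt

end AbelianVariety

end Literature.AlgebraicGeometry.Motives

end
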